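import Mathlib
import Summits.KontsevichZagierPeriods.KontsevichZagierPeriods.Theorems.SoloInformedKummerHeumanBand
import Summits.KontsevichZagierPeriods.KontsevichZagierPeriods.Theorems.SoloInformedKummerZetaMoves
import Literature.NumberTheory.Transcendental.EllIterRep
import HarnessLib
import HarnessLib.Audit

/-!
# Kummer family V: the circular reciprocity law for the third kind, IV — the two moves (s41)

Fourth file of THEOREM XXVIII(b) of the residency paper (§6quattuordecies; files I–III =
`SoloInformedKummerHeumanKernel`, `…Profile`, `…Band`).  The two Kontsevich–Zagier moves behind
the circular reciprocity law, on the open band `B = (0,1) × (s₁,1)` (`z 0 = x`, `z 1 = s`,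
`0 < s₁ < 1` algebraic):

* `soloInformed_kummerHeuman_deformation` — Newton–Leibniz in `s` over the closed band
  `(0,1) × [s₁,1]` (rule 3) and opening of the fibres (rule 1a):
  `[B, R(x,s)κ(x)κ'(s)] ∼ [(0,1), −Ψ(x,s₁)]` (`Ψ(x,1) = 0`);
* `soloInformed_kummerHeuman_killed` — fibrewise Newton–Leibniz in `x` over `(s₁,1) × [0,1]`
  (`Ξ(0,s) = Ξ(1,s) = 0`), fibres opened, coordinates swapped (rules 3, 1a, 2):
  `[B, S(x,s)κ(x)κ'(s)] ∼ 0`.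

References: M. Kontsevich, D. Zagier, *Periods* (2001), §1.2; this work (solo-informed s41).
-/

noncomputable section

open MeasureTheory Set Filter
open scoped Classical

open Literature.NumberTheory.Transcendental Literature.NumberTheory.Transcendental.KZ
open Literature.ModelTheory.ExponentialFields

namespace Summit.KontsevichZagierPeriods.KontsevichZagierPeriods.Theorems

/-! ### The deformation: Newton–Leibniz in `s` over `(0,1) × [s₁,1]` -/

/-- **Deformation move.**  For `m, s₁ ∈ (0,1)` algebraic there are representations
`r' = [(0,1)×(s₁,1), R(x,s)κ(x)κ'(s)]` and `rd = [(0,1), −Ψ(x,s₁)]` with `r' ∼ rd`: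
Newton–Leibniz in `s` (rule 3; `Ψ(x,1) = 0`) and opening of the fibres (rule 1a).
[cite: KontsevichZagier2001, §1.2] [this work] -/
theorem soloInformed_kummerHeuman_deformation (m s₁ : ℝ) (hm : m ∈ Ioo (0:ℝ) 1)
    (hma : IsAlgebraic ℚ m) (hs₁ : s₁ ∈ Ioo (0:ℝ) 1) (hs₁a : IsAlgebraic ℚ s₁) :
    ∃ (r' : IntegralRep 2) (rd : IntegralRep 1),
      r'.domain = {z : Fin 2 → ℝ | z 0 ∈ Ioo (0:ℝ) 1 ∧ z 1 ∈ Ioo s₁ 1} ∧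
      (r'.integrand = fun z => soloInformedKummerHeumanR m (z 0) (z 1) *
        ((√(1 - z 0 ^ 2))⁻¹ * (√(1 - m * z 0 ^ 2))⁻¹) *
        ((√(1 - z 1 ^ 2))⁻¹ * (√(1 - (1 - m) * z 1 ^ 2))⁻¹)) ∧
      rd.domain = {x : Fin 1 → ℝ | x 0 ∈ Ioo (0:ℝ) 1} ∧
      (rd.integrand = fun x => -soloInformedKummerHeumanPsi m (x 0) s₁) ∧
      of r' - of rd ∈ relations := by
  have snoc0 : ∀ (x : Fin 1 → ℝ) (c : ℝ), (Fin.snoc x c : Fin 2 → ℝ) 0 = x 0 := fun _ _ => rfl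
  have snoc1 : ∀ (x : Fin 1 → ℝ) (c : ℝ), (Fin.snoc x c : Fin 2 → ℝ) 1 = c := fun _ _ => rfl
  have hl : (Fin.last 1 : Fin 2) = 1 := rfl
  have hB : IsSemialgebraic ℚ {y : Fin 1 → ℝ | y 0 ∈ Ioo (0:ℝ) 1} :=
    BallPeeling.isSemialgebraic_posIoo
  have hBm : MeasurableSet {y : Fin 1 → ℝ | y 0 ∈ Ioo (0:ℝ) 1} :=
    IsSemialgebraic.measurableSet_holds hB
  have hlosa : IsSemialgebraicFunOn ℚ {y : Fin 1 → ℝ | y 0 ∈ Ioo (0:ℝ) 1} (fun _ => s₁) :=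
    isSemialgebraicFunOn_const_of_isAlgebraic hB hs₁a
  have h1sa : IsSemialgebraicFunOn ℚ {y : Fin 1 → ℝ | y 0 ∈ Ioo (0:ℝ) 1} (fun _ => (1:ℝ)) :=
    isSemialgebraicFunOn_const_of_isAlgebraic hB isAlgebraic_one
  have hmem : ∀ u : Fin 2 → ℝ, u ∈ KZlog.band {y : Fin 1 → ℝ | y 0 ∈ Ioo (0:ℝ) 1}
      (fun _ => s₁) (fun _ => 1) ↔ u 0 ∈ Ioo (0:ℝ) 1 ∧ s₁ ≤ u 1 ∧ u 1 ≤ 1 := fun u => by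
    simp only [KZlog.mem_band, mem_setOf_eq, Fin.init, Fin.castSucc_zero, hl]
  have hband : IsSemialgebraic ℚ (KZlog.band {y : Fin 1 → ℝ | y 0 ∈ Ioo (0:ℝ) 1}
      (fun _ => s₁) (fun _ => 1)) := KZlog.isSemialgebraic_band hlosa h1sa
  -- semialgebraicity and integrability on the closed band
  obtain ⟨hF, hf, -, -⟩ := soloInformed_kummerHeuman_sa_two' hm hma hband fun w hw => by
    rw [hmem] at hw
    exact ⟨⟨by linarith [hw.1.1], hw.1.2⟩, by linarith [hw.2.1, hs₁.1], hw.2.2⟩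
  have hint := soloInformed_kummerHeuman_integrableOn_gR hm hma hs₁ hband fun w hw => by
    rw [hmem] at hw
    exact ⟨hw.1, hw.2.1, hw.2.2⟩
  -- continuity and derivative along the fibres
  have hcont : ∀ x ∈ {y : Fin 1 → ℝ | y 0 ∈ Ioo (0:ℝ) 1},
      ContinuousOn (fun t : ℝ => (fun w : Fin 2 → ℝ => soloInformedKummerHeumanPsi m (w 0) (w 1))
        (Fin.snoc x t)) (Icc ((fun _ : Fin 1 → ℝ => s₁) x) ((fun _ : Fin 1 → ℝ => (1:ℝ)) x)) := by
    intro x hx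
    have h : x 0 ∈ Ioo (0:ℝ) 1 := hx
    have ha2 : x 0 ^ 2 < 1 := by nlinarith [h.1, h.2]
    simp only [snoc0, snoc1]
    exact (soloInformed_kummerHeumanPsi_continuous hm ha2).continuousOn
  have hder : ∀ x ∈ {y : Fin 1 → ℝ | y 0 ∈ Ioo (0:ℝ) 1},
      ∀ t ∈ Ioo ((fun _ : Fin 1 → ℝ => s₁) x) ((fun _ : Fin 1 → ℝ => (1:ℝ)) x),
      HasDerivAt (fun t : ℝ => (fun w : Fin 2 → ℝ => soloInformedKummerHeumanPsi m (w 0) (w 1))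
        (Fin.snoc x t))
        ((fun w : Fin 2 → ℝ => soloInformedKummerHeumanR m (w 0) (w 1) *
          ((√(1 - w 0 ^ 2))⁻¹ * (√(1 - m * w 0 ^ 2))⁻¹) *
          ((√(1 - w 1 ^ 2))⁻¹ * (√(1 - (1 - m) * w 1 ^ 2))⁻¹)) (Fin.snoc x t)) t := by
    intro x hx t ht
    have h : x 0 ∈ Ioo (0:ℝ) 1 := hx
    have ha2 : x 0 ^ 2 < 1 := by nlinarith [h.1, h.2]
    have ht' : s₁ < t ∧ t < 1 := ht
    have ht2 : t ^ 2 < 1 := by nlinarith [ht'.1, ht'.2, hs₁.1]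
    simp only [snoc0, snoc1]
    exact soloInformed_kummerHeumanPsi_hasDerivAt hm ha2 ht2
  -- the boundary function `Ψ(x,1) − Ψ(x,s₁) = −Ψ(x,s₁)`: semialgebraic and integrable on `(0,1)`
  have hφ : IsSemialgebraicMapOn ℚ {y : Fin 1 → ℝ | y 0 ∈ Ioo (0:ℝ) 1}
      (fun x => (Fin.snoc x s₁ : Fin 2 → ℝ)) := by
    refine IsSemialgebraicMapOn.of_forall hB fun j => ?_
    induction j using Fin.lastCases with
    | last => simp only [Fin.snoc_last]; exact hlosa
    | cast i => simp only [Fin.snoc_castSucc]; exact isSemialgebraicFunOn_apply hB i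
  have hmaps : MapsTo (fun x => (Fin.snoc x s₁ : Fin 2 → ℝ)) {y : Fin 1 → ℝ | y 0 ∈ Ioo (0:ℝ) 1}
      (KZlog.band {y : Fin 1 → ℝ | y 0 ∈ Ioo (0:ℝ) 1} (fun _ => s₁) (fun _ => 1)) :=
    fun x hx => KZlog.snoc_mem_band.2 ⟨hx, le_rfl, hs₁.2.le⟩
  have hsas : IsSemialgebraicFunOn ℚ {y : Fin 1 → ℝ | y 0 ∈ Ioo (0:ℝ) 1}
      (fun x => -soloInformedKummerHeumanPsi m (x 0) s₁) := by
    refine (hF.comp_isSemialgebraicMapOn_holds hφ hmaps).neg.congr fun x _ => ?_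
    simp only [Pi.neg_apply, Function.comp_apply, snoc0, snoc1]
  have hds : IsSemialgebraicFunOn ℚ {y : Fin 1 → ℝ | y 0 ∈ Ioo (0:ℝ) 1}
      (fun x => (fun w : Fin 2 → ℝ => soloInformedKummerHeumanPsi m (w 0) (w 1))
          (Fin.snoc x ((fun _ : Fin 1 → ℝ => (1:ℝ)) x)) -
        (fun w : Fin 2 → ℝ => soloInformedKummerHeumanPsi m (w 0) (w 1))
          (Fin.snoc x ((fun _ : Fin 1 → ℝ => s₁) x))) := by
    refine hsas.congr fun x _ => ?_
    simp only [snoc0, snoc1, soloInformed_kummerHeumanPsi_right_one, zero_sub]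
  have h1m : 0 < 1 - m := by linarith [hm.2]
  have hd : 0 < (1 - m) * s₁ ^ 2 := mul_pos h1m (pow_pos hs₁.1 2)
  have hdis : IntegrableOn (fun x : Fin 1 → ℝ => -soloInformedKummerHeumanPsi m (x 0) s₁)
      {y : Fin 1 → ℝ | y 0 ∈ Ioo (0:ℝ) 1} := by
    refine soloInformed_integrableOn_of_le_inv_sqrt_prod hB hsas ∅ {0} ∅ {0}
      (((1 - m) * s₁ ^ 2)⁻¹ * (√(1 - m))⁻¹) ∅ measure_empty (fun x hx _ j => ?_) (fun x _ hc => ?_)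
    · have h : x 0 ∈ Ioo (0:ℝ) 1 := hx
      fin_cases j
      exact h
    · have ha := hc 0
      have hx2 : x 0 ^ 2 ≤ 1 := by nlinarith [ha.1, ha.2]
      have hdD := (soloInformed_kummerHeuman_denom_ge hm hx2 hs₁.1.le le_rfl hs₁.2.le).1
      have hP := soloInformed_kummerHeumanPsi_abs_le hm ⟨ha.1.le, ha.2⟩ ⟨hs₁.1.le, hs₁.2.le⟩ hd hdD
      have hX : 0 ≤ (√(1 - x 0))⁻¹ := by positivity
      have hC : 0 ≤ ((1 - m) * s₁ ^ 2)⁻¹ * (√(1 - m))⁻¹ := by positivity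
      rw [Finset.prod_empty, Finset.prod_singleton, one_mul, abs_neg]
      calc |soloInformedKummerHeumanPsi m (x 0) s₁|
          ≤ ((1 - m) * s₁ ^ 2)⁻¹ * ((√(1 - x 0))⁻¹ * (√(1 - m))⁻¹) := hP
        _ ≤ ((1 - m) * s₁ ^ 2)⁻¹ * (√(1 - m))⁻¹ * ((√(1 - x 0))⁻¹ + (√(1 - x 0))⁻¹) := by
            nlinarith [mul_nonneg hC hX]
  have hdi : IntegrableOn
      (fun x => (fun w : Fin 2 → ℝ => soloInformedKummerHeumanPsi m (w 0) (w 1))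
          (Fin.snoc x ((fun _ : Fin 1 → ℝ => (1:ℝ)) x)) -
        (fun w : Fin 2 → ℝ => soloInformedKummerHeumanPsi m (w 0) (w 1))
          (Fin.snoc x ((fun _ : Fin 1 → ℝ => s₁) x)))
      {y : Fin 1 → ℝ | y 0 ∈ Ioo (0:ℝ) 1} := by
    refine hdis.congr_fun (fun x _ => ?_) hBm
    simp only [snoc0, snoc1, soloInformed_kummerHeumanPsi_right_one, zero_sub]
  -- Newton–Leibniz in `s`, then open the fibres
  obtain ⟨rb, rd, hrbd, hrbi, hrdd, hrdi, hrel⟩ := exists_band_newtonLeibniz hB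
    (fun _ => s₁) (fun _ => (1:ℝ)) hlosa h1sa (fun _ _ => hs₁.2.le) _ _ hF hf hcont hder hint
    hds hdi
  obtain ⟨r', hr'd, hr'i, hrel'⟩ := of_sub_of_restrict_openBand_mem_relations hlosa h1sa rb hrbd
  refine ⟨r', rd, ?_, by rw [hr'i, hrbi], hrdd, ?_, ?_⟩
  · rw [hr'd]
    ext z
    simp only [mem_setOf_eq, Fin.init, Fin.castSucc_zero, hl, mem_Ioo]
  · rw [hrdi]
    funext x
    simp only [snoc0, snoc1, soloInformed_kummerHeumanPsi_right_one, zero_sub]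
  · have h := relations.sub_mem hrel hrel'
    have e : of r' - of rd = of rb - of rd - (of rb - of r') := by abel
    rw [e]
    exact h

/-! ### The kill: Newton–Leibniz in `x` over `(s₁,1) × [0,1]`, fibres opened, coordinates swapped -/

/-- **Kill move.**  For `m, s₁ ∈ (0,1)` algebraic, `[(0,1)×(s₁,1), S(x,s)κ(x)κ'(s)] ∼ 0`
(`z 0 = x`, `z 1 = s`): `Ξ(0,s) = Ξ(1,s) = 0`. [cite: KontsevichZagier2001, §1.2] [this work] -/
theorem soloInformed_kummerHeuman_killed (m s₁ : ℝ) (hm : m ∈ Ioo (0:ℝ) 1)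
    (hma : IsAlgebraic ℚ m) (hs₁ : s₁ ∈ Ioo (0:ℝ) 1) (hs₁a : IsAlgebraic ℚ s₁) :
    ∃ T : IntegralRep 2, T.domain = {z : Fin 2 → ℝ | z 0 ∈ Ioo (0:ℝ) 1 ∧ z 1 ∈ Ioo s₁ 1} ∧
      (T.integrand = fun z => soloInformedKummerHeumanS m (z 0) (z 1) *
        ((√(1 - z 0 ^ 2))⁻¹ * (√(1 - m * z 0 ^ 2))⁻¹) *
        ((√(1 - z 1 ^ 2))⁻¹ * (√(1 - (1 - m) * z 1 ^ 2))⁻¹)) ∧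
      of T ∈ relations := by
  have snoc0 : ∀ (x : Fin 1 → ℝ) (c : ℝ), (Fin.snoc x c : Fin 2 → ℝ) 0 = x 0 := fun _ _ => rfl
  have snoc1 : ∀ (x : Fin 1 → ℝ) (c : ℝ), (Fin.snoc x c : Fin 2 → ℝ) 1 = c := fun _ _ => rfl
  have hl : (Fin.last 1 : Fin 2) = 1 := rfl
  have hB₂ : IsSemialgebraic ℚ {y : Fin 1 → ℝ | y 0 ∈ Ioo s₁ 1} :=
    (isSemialgebraic_setOf_const_lt_apply hs₁a 0).inter
      (isSemialgebraic_setOf_apply_lt_const isAlgebraic_one 0)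
  have hmem : ∀ u : Fin 2 → ℝ, u ∈ KZlog.band {y : Fin 1 → ℝ | y 0 ∈ Ioo s₁ 1}
      (fun _ => 0) (fun _ => 1) ↔ u 0 ∈ Ioo s₁ 1 ∧ 0 ≤ u 1 ∧ u 1 ≤ 1 := fun u => by
    simp only [KZlog.mem_band, mem_setOf_eq, Fin.init, Fin.castSucc_zero, hl]
  have hband : IsSemialgebraic ℚ (KZlog.band {y : Fin 1 → ℝ | y 0 ∈ Ioo s₁ 1}
      (fun _ => 0) (fun _ => 1)) :=
    KZlog.isSemialgebraic_band (isSemialgebraicFunOn_const_of_isAlgebraic hB₂ isAlgebraic_zero)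
      (isSemialgebraicFunOn_const_of_isAlgebraic hB₂ isAlgebraic_one)
  obtain ⟨-, -, hP, hg⟩ := soloInformed_kummerHeuman_sa_two' hm hma hband fun u hu => by
    rw [hmem] at hu
    exact ⟨⟨by linarith [hu.1.1, hs₁.1], hu.1.2⟩, by linarith [hu.2.1], hu.2.2⟩
  have hint := soloInformed_kummerHeuman_integrableOn_gS hm hma hs₁ hband fun u hu => by
    rw [hmem] at hu
    exact ⟨hu.1, hu.2.1, hu.2.2⟩
  have hcont : ∀ y ∈ {y : Fin 1 → ℝ | y 0 ∈ Ioo s₁ 1},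
      ContinuousOn (fun b : ℝ => (fun w : Fin 2 → ℝ => soloInformedKummerHeumanXi m (w 1) (w 0))
        (Fin.snoc y b)) (Icc 0 1) := by
    intro y hy
    have h : y 0 ∈ Ioo s₁ 1 := hy
    have hy0 : y 0 ≠ 0 := (hs₁.1.trans h.1).ne'
    simp only [snoc0, snoc1]
    exact soloInformed_kummerHeumanXi_continuousOn hm hy0
  have hder : ∀ y ∈ {y : Fin 1 → ℝ | y 0 ∈ Ioo s₁ 1}, ∀ b ∈ Ioo (0:ℝ) 1,
      HasDerivAt (fun b : ℝ => (fun w : Fin 2 → ℝ => soloInformedKummerHeumanXi m (w 1) (w 0))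
        (Fin.snoc y b))
        ((fun w : Fin 2 → ℝ => soloInformedKummerHeumanS m (w 1) (w 0) *
          ((√(1 - w 1 ^ 2))⁻¹ * (√(1 - m * w 1 ^ 2))⁻¹) *
          ((√(1 - w 0 ^ 2))⁻¹ * (√(1 - (1 - m) * w 0 ^ 2))⁻¹)) (Fin.snoc y b)) b := by
    intro y hy b hb
    have h : y 0 ∈ Ioo s₁ 1 := hy
    have hs2 : y 0 ^ 2 < 1 := by nlinarith [h.1, h.2, hs₁.1]
    have hb2 : b ^ 2 < 1 := by nlinarith [hb.1, hb.2]
    simp only [snoc0, snoc1]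
    exact soloInformed_kummerHeumanXi_hasDerivAt hm hb2 hs2
  have h0 : ∀ y ∈ {y : Fin 1 → ℝ | y 0 ∈ Ioo s₁ 1},
      (fun w : Fin 2 → ℝ => soloInformedKummerHeumanXi m (w 1) (w 0)) (Fin.snoc y 1) -
        (fun w : Fin 2 → ℝ => soloInformedKummerHeumanXi m (w 1) (w 0)) (Fin.snoc y 0) = 0 := by
    intro y _
    simp only [snoc0, snoc1, soloInformed_kummerHeumanXi_left_zero,
      soloInformed_kummerHeumanXi_left_one, sub_zero]
  have he0 : Equiv.swap (0 : Fin 2) 1 0 = 1 := by decide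
  have he1 : Equiv.swap (0 : Fin 2) 1 1 = 0 := by decide
  obtain ⟨T, hTd, hTi, hT⟩ := soloInformed_kummerZeta_kill _ hB₂ _ _ hP hg hcont hder hint h0
    (Equiv.swap 0 1)
  refine ⟨T, ?_, ?_, hT⟩
  · rw [hTd]
    ext w
    simp only [mem_setOf_eq, Fin.init, Fin.castSucc_zero, hl, he0, he1, mem_Ioo]
    constructor
    · rintro ⟨h1, h2, h3⟩; exact ⟨⟨h2, h3⟩, h1⟩
    · rintro ⟨⟨h2, h3⟩, h1⟩; exact ⟨h1, h2, h3⟩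
  · rw [hTi]
    funext w
    simp only [he0, he1]

end Summit.KontsevichZagierPeriods.KontsevichZagierPeriods.Theorems
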